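import Summits.Ventures.KdS.RouteWRealAxisHighSpin
import HarnessLib

/-!
# Venture KdS — the threshold rays on the REAL axis: Casals–Teixeira da Costa's Theorem 3.10,
# second bullet (window clause for every spin), with NO generic-regime disjunction

HONEST FRAMING (venture `Summits/Ventures/KdS`, cell `pub-kds`; optional kernel object of the
Monday S3 seat, one screen over LANDED files: `RouteWRealAxisHighSpin` / `RouteWRealAxisLattice`
(LIT-1 g23), `RouteWRealAxis` (route W at `Im ω = 0`)). The tree's real-axis bullet for every spin,
`RouteW.realAxis_vanishing_allSpins`, carries the printed GENERIC-REGIME disjunction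
`Re ω ≠ mϖ₁ ∨ s ≤ 0`, used at one place only: `realAxis_vanishing_lattice` needs `Re ω ≠ mϖ₁` to
keep the formal-Euler-partner weights non-zero. On the real axis that hypothesis is AUTOMATIC: the
cosmological lattice datum `s + 2B(r_c) = j` forces `Re ω = mϖ_c` (`im_re_of_lattice`), so a real
frequency on the lattice AND on the event threshold ray `Re ω = mϖ₊` has `m(ϖ₊ − ϖ_c) = 0`, i.e.
`m = 0` for `a > 0` (`eq_zero_of_two_rays`, `ϖ_c < ϖ₊`) and `ϖ = 0` for `a = 0` — either way
`ω = Re ω = 0` (`eq_zero_of_lattice_eventRay_real`), excluded by Definition 3.4's standing `ω ≠ 0`.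
Hence ★ `realAxis_vanishing_noRay`: subextremal, `0 ≤ a`, `2s ∈ ℤ`, `ω ∈ ℝ∖{0}`, `Im λ̄ = 0`,
`m = 0 ∨ ω/m ∉ (Ω_low, Ω_SR)` ⟹ every generic-bullet radial Teukolsky solution vanishes on
`(r₊, r_c)` — the real-axis bullet with the window clause for every spin and no threshold-ray
disjunction (0 facts). The bookkeeping lemmas `im_re_of_lattice`, `im_of_eventRay_resonance`,
`eq_zero_of_two_rays` are stated for general `ω` (they serve the doubly-resonant analysis of the
open upper half-plane, `RouteWDoublyResonantCandidate` / `RouteWNonExtremeStrata`, as well). The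
fermionic superradiant-window clause itself (`|s| ∈ {1/2, 3/2}`, `ω/m ∈ (Ω_low, Ω_SR)`) is NOT
touched (see `RouteWFermionicRealAxis`); nothing here is a statement about nonlinear stability or
the Final State Conjecture. 0 cited facts, no `sorry`.
-/

noncomputable section

open Set Complex

namespace Summit.Ventures.KdS

namespace RouteW

open Literature.Geometry.Lorentzian Literature.Geometry.Lorentzian.KerrDeSitter

/-! ### Threshold-ray bookkeeping (general `ω`) -/

/-- **The lattice datum, real and imaginary parts.** `s + 2B(r_c) = j` (real `j`) gives
`Im ω = (j − s)κ_c` and `Re ω = mϖ_c`. -/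
theorem im_re_of_lattice {M a Λ : ℝ} (hsub : IsSubextremal M a Λ) {s : ℝ} {ω : ℂ} {m j : ℝ}
    (hlat : (s : ℂ) + 2 * horizonB M a Λ ω m (rCosmo M a Λ) = (j : ℂ)) :
    ω.im = (j - s) * surfaceGravity M a Λ (rCosmo M a Λ) ∧
      ω.re = m * horizonAngVel a (rCosmo M a Λ) := by
  have hκ := surfaceGravity_rCosmo_pos hsub
  have hB := horizonB_rCosmo_eq_neg_etaCosmo hsub ω m
  have hlat' : (s : ℂ) - 2 * etaCosmo M a Λ ω m = (j : ℂ) := by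
    linear_combination hlat - 2 * hB
  constructor
  · have hre := congrArg Complex.re hlat'
    simp only [sub_re, ofReal_re, mul_re, re_ofNat, im_ofNat, etaCosmo_re, etaCosmo_im, zero_mul,
      sub_zero] at hre
    field_simp at hre
    linarith
  · have him := congrArg Complex.im hlat'
    simp only [sub_im, ofReal_im, mul_im, re_ofNat, im_ofNat, etaCosmo_re, etaCosmo_im, zero_mul,
      add_zero, zero_sub] at him
    field_simp at him
    linarith

/-- **The event-ray resonance datum.** On the event threshold ray `Re ω = mϖ₊`, `η₁` is real and
`2η₁ − s + 1 + i₀ = 0` reads `Im ω = (s − 1 − i₀)κ₊`. -/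
theorem im_of_eventRay_resonance {M a Λ : ℝ} (hsub : IsSubextremal M a Λ) {s i₀ : ℝ} {ω : ℂ}
    {m : ℝ} (hray : ω.re = m * horizonAngVel a (rPlus M a Λ))
    (hres : 2 * etaEvent M a Λ ω m - (s : ℂ) + 1 + (i₀ : ℂ) = 0) :
    ω.im = (s - 1 - i₀) * surfaceGravity M a Λ (rPlus M a Λ) := by
  have hκ := surfaceGravity_rPlus_pos hsub
  have hη : etaEvent M a Λ ω m =
      ((ω.im / (2 * surfaceGravity M a Λ (rPlus M a Λ)) : ℝ) : ℂ) := by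
    apply Complex.ext
    · rw [ofReal_re, etaEvent_re]
    · rw [ofReal_im, etaEvent_im, hray, sub_self, zero_div, neg_zero]
  rw [hη] at hres
  have h'' : 2 * (ω.im / (2 * surfaceGravity M a Λ (rPlus M a Λ))) - s + 1 + i₀ = 0 := by
    exact_mod_cast hres
  field_simp at h''
  linarith

/-- **Both threshold rays at once force `m = 0`** (for `a > 0`, `ϖ_c < ϖ₊`). -/
theorem eq_zero_of_two_rays {M a Λ : ℝ} (hsub : IsSubextremal M a Λ) (ha : 0 < a) {ω : ℂ} {m : ℝ}
    (h₁ : ω.re = m * horizonAngVel a (rPlus M a Λ))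
    (h₂ : ω.re = m * horizonAngVel a (rCosmo M a Λ)) : m = 0 := by
  have hϖ := horizonAngVel_rCosmo_lt_rPlus hsub ha
  have : m * (horizonAngVel a (rPlus M a Λ) - horizonAngVel a (rCosmo M a Λ)) = 0 := by
    linear_combination h₂ - h₁
  rcases mul_eq_zero.mp this with h | h
  · exact h
  · exfalso; linarith

/-- **On the real axis the lattice and the event threshold ray meet only at `ω = 0`.** For
`0 ≤ a`, `Im ω = 0`, `s + 2B(r_c) = j` and `Re ω = mϖ₊`: `ω = 0` (`a > 0`: `m = 0`; `a = 0`: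
`ϖ₊ = 0`). -/
theorem eq_zero_of_lattice_eventRay_real {M a Λ : ℝ} (hsub : IsSubextremal M a Λ) (ha : 0 ≤ a)
    {s : ℝ} {ω : ℂ} {m j : ℝ} (hω : ω.im = 0)
    (hlat : (s : ℂ) + 2 * horizonB M a Λ ω m (rCosmo M a Λ) = (j : ℂ))
    (hray : ω.re = m * horizonAngVel a (rPlus M a Λ)) : ω = 0 := by
  obtain ⟨-, hray₂⟩ := im_re_of_lattice hsub hlat
  have hre : ω.re = 0 := by
    rcases eq_or_lt_of_le ha with ha0 | ha0
    · rw [hray, ← ha0, horizonAngVel_zero_a, mul_zero]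
    · rw [hray, eq_zero_of_two_rays hsub ha0 hray hray₂, zero_mul]
  exact Complex.ext hre hω

/-! ### The real-axis bullet with no threshold-ray disjunction -/

/-- ★ **CTdC Theorem 3.10, real-axis bullet, window clause for every spin, NO generic-regime
disjunction — PROVED, 0 cited facts.** Subextremal, `0 ≤ a`, `2s ∈ ℤ`, `ω ∈ ℝ∖{0}`, `Im λ̄ = 0`,
`m = 0 ∨ ω/m ∉ (Ω_low, Ω_SR)` ⟹ every generic-boundary radial Teukolsky solution vanishes on
`(r₊, r_c)`. (`s < 1`: `realAxis_vanishing_lt_one`; `s ≥ 1` off the event ray: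
`realAxis_vanishing_allSpins`; `s ≥ 1` on the event ray: off the lattice
`realAxis_vanishing_offLattice`, on it `ω = 0` by `eq_zero_of_lattice_eventRay_real`.)
[cite: CasalsTeixeiradacosta2022, Theorem 3.10 (second bullet)] -/
theorem realAxis_vanishing_noRay {M a Λ s : ℝ} {ω : ℂ} {m : ℝ} {lam : ℂ} {R : ℝ → ℂ}
    (hsub : IsSubextremal M a Λ) (ha : 0 ≤ a) (h2s : ∃ k : ℤ, 2 * s = k)
    (hω : ω.im = 0) (hω0 : ω ≠ 0) (hlam : (lambdaBar a Λ s ω m lam).im = 0)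
    (hthird : m = 0 ∨
      ¬(superradiantLower M a Λ < ω.re / m ∧ ω.re / m < superradiantUpper M a Λ))
    (hR : IsRadialTeukolskySolution M a Λ s ω m lam R) (hin : IsIngoingAtEventHorizon M a Λ s ω m R)
    (hout : IsOutgoingAtCosmoHorizon M a Λ ω m R) :
    ∀ r ∈ Ioo (rPlus M a Λ) (rCosmo M a Λ), R r = 0 := by
  by_cases hray : ω.re ≠ m * horizonAngVel a (rPlus M a Λ)
  · exact realAxis_vanishing_allSpins hsub ha h2s hω hω0 hlam hthird (Or.inl hray) hR hin hout
  rw [not_ne_iff] at hray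
  by_cases hs : s < 1
  · exact realAxis_vanishing_lt_one hsub ha hs hω hω0 hlam hthird hR hin hout
  obtain ⟨k, hk⟩ := h2s
  have hk1 : (1 : ℤ) ≤ k := by exact_mod_cast (show (1 : ℝ) ≤ (k : ℝ) by rw [← hk]; linarith)
  obtain ⟨N, hNk⟩ : ∃ N : ℕ, (N : ℤ) = k := ⟨k.toNat, Int.toNat_of_nonneg (by omega)⟩
  have hsN : 2 * s = (N : ℝ) := by rw [hk]; exact_mod_cast hNk.symm
  have hN1 : 1 ≤ N := by exact_mod_cast (hNk ▸ hk1 : (1 : ℤ) ≤ (N : ℤ))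
  by_cases hoff : OffLattice M a Λ s ω m
  · exact realAxis_vanishing_offLattice hsub ha hN1 hsN hω hω0 hlam hthird hoff hR hin hout
  obtain ⟨j, -, hj'⟩ : ∃ j : ℤ, (j : ℝ) ≤ 2 * s - 1 ∧
      (s : ℂ) + 2 * horizonB M a Λ ω m (rCosmo M a Λ) = j := by
    by_contra h
    exact hoff fun j hj hj' => h ⟨j, hj, hj'⟩
  have hlat : (s : ℂ) + 2 * horizonB M a Λ ω m (rCosmo M a Λ) = ((j : ℝ) : ℂ) := by
    rw [hj']; norm_cast
  exact absurd (eq_zero_of_lattice_eventRay_real hsub ha hω hlat hray) hω0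

end RouteW

end Summit.Ventures.KdS
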